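import Summits.AtomisticToContinuum.HydrodynamicLimit.Theorems.OneFlightGossipEngineEnergyCurrentTailsLevelCensusEventMeasurable
import Summits.AtomisticToContinuum.HydrodynamicLimit.Theorems.JParityClosureRateFloorWindowFloorRung0
import Summits.AtomisticToContinuum.HydrodynamicLimit.Theorems.JParityClosureRateFloorMarkedTransfer
import Summits.AtomisticToContinuum.HydrodynamicLimit.Theorems.JParityClosureRateFloorRealisedDatum
import Summits.AtomisticToContinuum.HydrodynamicLimit.Theorems.JParityClosureRateFloorNoBurstsRung0Glue
import HarnessLib

/-!
# Splitting floor at rung 0 (helper of `stub_splitFloorRung0`, line `level-census-comparison`, crux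
# `EnergyCurrentTails`, stmt-AtomisticToContinuum-9235): the pathwise floor of one window

Helper file of the rung-0 certificate `stub_splitFloorRung0` of the splitting floor F3 (objects `eventSum`,
`splitEvent` of `…Theorems.OneFlightGossipEngineEnergyCurrentTailsLevelCensusObjects`).  DETERMINISTIC step of the
fixed-`N` small-window argument (registered helper `splitFloorRung0_pathwise`): on the good set of a hard-sphere flow
`Φ` on `𝕋³`, for a window `(s, s + κε]` and a mark `0 ≤ Ξ ≤ 1` on (impact normal, incoming velocities) carrying the
speed cutoffs of the tube functional and nonzero only on the SPLITTING geometry of level `E`,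

  `Σᵢ Σⱼ [i ≠ j] pairTubeMark ε κ Ξ i j (Φ_s z) ≤ 2 · eventSum Φ s (s + κε) (splitEvent E) z + D(Φ_s z)`   (in `ℝ≥0∞`),

`D(w) = Σ_{p ∈ W} #{q ∈ W : q ∉ {p, p.swap}}` the PAIR EXCESS of the ordered would-be pairs `W = wouldBePairs ε (κε) w`
of the window (`…RateFloorLineDefs`).  Chain: the static tube sum is at most the would-be marked sum of the line
`Sketch` (`RateFloorWindowFloor.tubeSum_trunc_le_wouldBeSum`); the would-be sum exceeds the realised one by at most
the number of non-realised would-be pairs (mark `≤ 1`); the realised marked sum is at most the window collision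
functional of the mark (`RateFloorMarkedTransfer.stub_markedTransfer RateFloorRealisedDatum.stub_realisedDatum`),
which is at most TWICE the once-per-collision splitting count since both orientations of a colliding pair carry the
same splitting indicator (`record_swap_mem_splitEvent_iff`, elastic law `ofConfig_postVel_eq_of_mem_contactSet`);
finally a would-be pair that is not realised is PRE-EMPTED: the first collision of the orbit after `s` happens
strictly before its first free contact time, between two particles that flew freely from `Φ_s z`, i.e. realises
ANOTHER would-be pair `q ∉ {p, p.swap}` (`card_sdiff_realisedPairs_le`, minimality of the first contact time,
`RateFloorMarkedTransfer.first_contact` / `apply_fst_eq_freeFlight_of_not_participates`).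

References: Gallagher–Saint-Raymond–Texier 2013 §4.1 (hard-sphere trajectories, collision cylinders);
Cercignani–Illner–Pulvirenti 1994 §2.2; elementary.
-/

noncomputable section

open MeasureTheory Set Filter
open scoped ENNReal InnerProductSpace BigOperators Classical

namespace Summit.AtomisticToContinuum.HydrodynamicLimit.Theorems.EnergyCurrentTailsLevelCensus

open Literature.MathematicalPhysics.KineticTheory Literature.Analysis.FluidPDE
open RateFloorLine RateFloorNoBursts

/-! ## The record of one collision: both orientations have the same splitting indicator -/

/-- The splitting event is invariant under the exchange of the two participants. [folklore] -/
theorem swap_mem_splitEvent_iff (E : ℝ) (q : VelEvent) :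
    ((q.1.swap, q.2.swap) : VelEvent) ∈ splitEvent E ↔ q ∈ splitEvent E := by
  simp only [splitEvent, maxPre, Set.mem_setOf_eq, Prod.fst_swap, Prod.snd_swap]
  rw [max_comm]
  tauto

/-- **Both orientations of a contact pair have the same splitting indicator.**  On `𝕋³` with `ε < 1/2`, at a
configuration in contact the record of `(j, i)` has the pre- and post-collisional pairs of the record of
`(i, j)` swapped (`sepVec_comm`, `reflectVel_neg`, `reflectVel_swap`). [folklore] -/
theorem record_swap_mem_splitEvent_iff {n : ℕ} {ε : ℝ} (hε2 : ε < 2⁻¹) {z : Config n (Fin 3) T3} {i j : Fin n}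
    (hc : z ∈ contactSet (Torus.geometry (Fin 3)) n ε i j) (t E : ℝ) :
    ((HardSphereCollisionRecord.ofConfig (Torus.geometry (Fin 3)) ε z t j i).preVel,
        (HardSphereCollisionRecord.ofConfig (Torus.geometry (Fin 3)) ε z t j i).postVel) ∈ splitEvent E ↔
      ((HardSphereCollisionRecord.ofConfig (Torus.geometry (Fin 3)) ε z t i j).preVel,
        (HardSphereCollisionRecord.ofConfig (Torus.geometry (Fin 3)) ε z t i j).postVel) ∈ splitEvent E := by
  have hG := Torus.isHardSphereRegular_geometry (d := Fin 3) hε2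
  have hn : (Torus.geometry (Fin 3)).sepVec (z j).1 (z i).1 = -(Torus.geometry (Fin 3)).sepVec (z i).1 (z j).1 :=
    hG.sepVec_comm _ _ (mem_contactSet.1 hc).2.le
  have hpre : (HardSphereCollisionRecord.ofConfig (Torus.geometry (Fin 3)) ε z t j i).preVel =
      ((HardSphereCollisionRecord.ofConfig (Torus.geometry (Fin 3)) ε z t i j).preVel).swap := by
    rw [HardSphereCollisionRecord.ofConfig_preVel, HardSphereCollisionRecord.ofConfig_preVel, hn, reflectVel_neg,
      Literature.Analysis.FluidPDE.reflectVel_swap _ ((z i).2, (z j).2)]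
    rfl
  have hpost : (HardSphereCollisionRecord.ofConfig (Torus.geometry (Fin 3)) ε z t j i).postVel =
      ((HardSphereCollisionRecord.ofConfig (Torus.geometry (Fin 3)) ε z t i j).postVel).swap := by
    simp only [HardSphereCollisionRecord.ofConfig_postVel, Prod.swap_prod_mk]
  rw [hpre, hpost]
  exact swap_mem_splitEvent_iff E
    ((HardSphereCollisionRecord.ofConfig (Torus.geometry (Fin 3)) ε z t i j).preVel,
      (HardSphereCollisionRecord.ofConfig (Torus.geometry (Fin 3)) ε z t i j).postVel)

/-- **Counting core, one collision time.**  Over a set of ordered pairs which is empty or the two orientations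
`{(a, b), (b, a)}` of one pair, marks `Ξ_p ≤ 1` that are nonzero only when the event `ev p ∈ S` holds, with
`S`-membership the same for both orientations, sum to at most twice the once-per-pair guarded indicator sum.
[folklore] -/
theorem ofReal_sum_le_two_mul_sum_guard {n : ℕ} {β : Type*} (CP : Finset (Fin n × Fin n)) (Xi : Fin n × Fin n → ℝ)
    (S : Set β) (ev : Fin n × Fin n → β) (hCP : CP = ∅ ∨ ∃ a b : Fin n, a ≠ b ∧ CP = {(a, b), (b, a)})
    (h1 : ∀ p, Xi p ≤ 1) (hM : ∀ p ∈ CP, Xi p ≠ 0 → ev p ∈ S)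
    (hsymm : ∀ p ∈ CP, ev p.swap ∈ S ↔ ev p ∈ S) :
    ENNReal.ofReal (∑ p ∈ CP, Xi p) ≤
      2 * ∑ p ∈ CP, (if p.1 < p.2 then S.indicator (fun _ => (1 : ℝ≥0∞)) (ev p) else 0) := by
  rcases hCP with hCP | ⟨a, b, hne, hCP⟩
  · rw [hCP, Finset.sum_empty, Finset.sum_empty, ENNReal.ofReal_zero]
    exact bot_le
  · have hne2 : ((a, b) : Fin n × Fin n) ≠ (b, a) := fun h => hne (Prod.mk.inj h).1
    have hab : ((a, b) : Fin n × Fin n) ∈ CP := by rw [hCP]; simp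
    have hba : ((b, a) : Fin n × Fin n) ∈ CP := by rw [hCP]; simp
    have hsy : ev (b, a) ∈ S ↔ ev (a, b) ∈ S := hsymm (a, b) hab
    rw [hCP, Finset.sum_pair hne2, Finset.sum_pair hne2]
    have hsum : (if a < b then S.indicator (fun _ => (1 : ℝ≥0∞)) (ev (a, b)) else 0) +
        (if b < a then S.indicator (fun _ => (1 : ℝ≥0∞)) (ev (b, a)) else 0) =
        S.indicator (fun _ => (1 : ℝ≥0∞)) (ev (a, b)) := by
      rcases lt_or_gt_of_ne hne with hlt | hgt
      · rw [if_pos hlt, if_neg (not_lt.2 hlt.le), add_zero]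
      · rw [if_neg (not_lt.2 hgt.le), if_pos hgt, zero_add]
        by_cases hm : ev (a, b) ∈ S
        · rw [Set.indicator_of_mem hm, Set.indicator_of_mem (hsy.2 hm)]
        · rw [Set.indicator_of_notMem hm, Set.indicator_of_notMem (fun h => hm (hsy.1 h))]
    rw [hsum]
    by_cases hm : ev (a, b) ∈ S
    · rw [Set.indicator_of_mem hm, mul_one]
      calc ENNReal.ofReal (Xi (a, b) + Xi (b, a)) ≤ ENNReal.ofReal (1 + 1) :=
            ENNReal.ofReal_le_ofReal (add_le_add (h1 _) (h1 _))
        _ = 2 := by norm_num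
    · have e1 : Xi (a, b) = 0 := by by_contra h; exact hm (hM _ hab h)
      have e2 : Xi (b, a) = 0 := by by_contra h; exact hm (hsy.1 (hM _ hba h))
      rw [e1, e2, add_zero, ENNReal.ofReal_zero]
      exact bot_le

/-! ## The collision functional of a splitting mark is at most twice the splitting count -/

section Flow

variable {σ : ℝ} {N : ℕ}

/-- **One collision time.**  On the good set, for a mark `F ≤ 1` that is nonzero only on the splitting geometry
(read at the UNIT impact vector `ε⁻¹ sepVec`), at every time `u` the marks `F(u, xᵢ, xⱼ, vᵢ⁻, vⱼ⁻)` of the ordered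
contact pairs of the orbit sum to at most twice the guarded splitting count of the records: the two orientations
of the colliding pair carry the same splitting indicator (`record_swap_mem_splitEvent_iff`), read off the record by
the elastic law (`ofConfig_postVel_eq_of_mem_contactSet`). [folklore] -/
theorem ofReal_sum_contactPairs_le (hσ : 0 < σ) (hσ2 : σ < 1 / 2) (Φ : Flow σ N)
    {z : Config (N + 1) (Fin 3) T3} (hz : z ∈ Φ.good) {F : ℝ → T3 → T3 → V3 → V3 → ℝ}
    (hF1 : ∀ u x y v w, F u x y v w ≤ 1) {E : ℝ}
    (hFs : ∀ (u : ℝ) (x y : T3) (v w : V3), ‖(hsDiameter σ N)⁻¹ • (Torus.geometry (Fin 3)).sepVec x y‖ = 1 →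
      F u x y v w ≠ 0 →
      (((v, w), (v - ⟪v - w, (hsDiameter σ N)⁻¹ • (Torus.geometry (Fin 3)).sepVec x y⟫_ℝ •
          (hsDiameter σ N)⁻¹ • (Torus.geometry (Fin 3)).sepVec x y,
        w + ⟪v - w, (hsDiameter σ N)⁻¹ • (Torus.geometry (Fin 3)).sepVec x y⟫_ℝ •
          (hsDiameter σ N)⁻¹ • (Torus.geometry (Fin 3)).sepVec x y)) : VelEvent) ∈ splitEvent E) (u : ℝ) :
    ENNReal.ofReal (∑ p ∈ contactPairs (Torus.geometry (Fin 3)) (hsDiameter σ N) (Φ.flow u z),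
        F u (Φ.flow u z p.1).1 (Φ.flow u z p.2).1
          (reflectVel ((Torus.geometry (Fin 3)).sepVec (Φ.flow u z p.1).1 (Φ.flow u z p.2).1)
            ((Φ.flow u z p.1).2, (Φ.flow u z p.2).2)).1
          (reflectVel ((Torus.geometry (Fin 3)).sepVec (Φ.flow u z p.1).1 (Φ.flow u z p.2).1)
            ((Φ.flow u z p.1).2, (Φ.flow u z p.2).2)).2) ≤
      2 * ∑ p ∈ contactPairs (Torus.geometry (Fin 3)) (hsDiameter σ N) (Φ.flow u z),
        (if p.1 < p.2 then (splitEvent E).indicator (fun _ => (1 : ℝ≥0∞))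
          ((HardSphereCollisionRecord.ofConfig (Torus.geometry (Fin 3)) (hsDiameter σ N) (Φ.flow u z) u p.1 p.2).preVel,
            (HardSphereCollisionRecord.ofConfig (Torus.geometry (Fin 3)) (hsDiameter σ N) (Φ.flow u z) u p.1 p.2).postVel)
          else 0) := by
  have hε : 0 < hsDiameter σ N := hsDiameter_pos hσ N
  have hε2 : hsDiameter σ N < 2⁻¹ := (hsDiameter_le hσ.le N).trans_lt (by norm_num at hσ2 ⊢; linarith)
  have hG : (Torus.geometry (Fin 3)).IsHardSphereRegular (hsDiameter σ N) := Torus.isHardSphereRegular_geometry hε2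
  have htraj := Φ.isTrajectory z hz
  refine ofReal_sum_le_two_mul_sum_guard (contactPairs (Torus.geometry (Fin 3)) (hsDiameter σ N) (Φ.flow u z))
    (fun p => F u (Φ.flow u z p.1).1 (Φ.flow u z p.2).1
      (reflectVel ((Torus.geometry (Fin 3)).sepVec (Φ.flow u z p.1).1 (Φ.flow u z p.2).1)
        ((Φ.flow u z p.1).2, (Φ.flow u z p.2).2)).1
      (reflectVel ((Torus.geometry (Fin 3)).sepVec (Φ.flow u z p.1).1 (Φ.flow u z p.2).1)
        ((Φ.flow u z p.1).2, (Φ.flow u z p.2).2)).2) (splitEvent E)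
    (fun p => ((HardSphereCollisionRecord.ofConfig (Torus.geometry (Fin 3)) (hsDiameter σ N) (Φ.flow u z) u p.1 p.2).preVel,
      (HardSphereCollisionRecord.ofConfig (Torus.geometry (Fin 3)) (hsDiameter σ N) (Φ.flow u z) u p.1 p.2).postVel))
    ?_ (fun p => hF1 _ _ _ _ _) ?_ ?_
  · by_cases hu : u ∈ collisionTimes (Torus.geometry (Fin 3)) (hsDiameter σ N) (fun t => Φ.flow t z)
    · obtain ⟨⟨a, b⟩, hab⟩ := mem_collisionTimes_iff_contactPairs_nonempty.1 hu
      exact Or.inr ⟨a, b, (mem_contactPairs.1 hab).1, htraj.contactPairs_eq_pair (t := u) hG hab⟩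
    · exact Or.inl (contactPairs_eq_empty_of_not_mem (γ := fun t => Φ.flow t z) hu)
  · intro p hp hne
    obtain ⟨-, hc⟩ := mem_contactPairs.1 hp
    have hω := HardSphereCollisionRecord.norm_ofConfig_impactVec hε u hc
    rw [HardSphereCollisionRecord.ofConfig_impactVec] at hω
    have hs := hFs u _ _ _ _ hω hne
    rw [ofConfig_postVel_eq_of_mem_contactSet hε u hc]
    simpa only [HardSphereCollisionRecord.ofConfig_preVel, HardSphereCollisionRecord.ofConfig_impactVec, Prod.mk.eta]
      using hs
  · intro p hp
    exact record_swap_mem_splitEvent_iff hε2 (mem_contactPairs.1 hp).2 u E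

/-- **Window by window.**  On the good set, the window collision functional
`Σ_{collisions in (s,t]} Σ_{ordered contact pairs} F(u, xᵢ, xⱼ, vᵢ⁻, vⱼ⁻)` of such a mark (the right-hand side of
the line `Sketch`'s marked transfer) is at most `2 · eventSum Φ s t (splitEvent E)`. [folklore] -/
theorem ofReal_collisionFunctional_le_two_mul_eventSum (hσ : 0 < σ) (hσ2 : σ < 1 / 2) (Φ : Flow σ N)
    {z : Config (N + 1) (Fin 3) T3} (hz : z ∈ Φ.good) {F : ℝ → T3 → T3 → V3 → V3 → ℝ}
    (hF0 : ∀ u x y v w, 0 ≤ F u x y v w) (hF1 : ∀ u x y v w, F u x y v w ≤ 1) {E : ℝ}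
    (hFs : ∀ (u : ℝ) (x y : T3) (v w : V3), ‖(hsDiameter σ N)⁻¹ • (Torus.geometry (Fin 3)).sepVec x y‖ = 1 →
      F u x y v w ≠ 0 →
      (((v, w), (v - ⟪v - w, (hsDiameter σ N)⁻¹ • (Torus.geometry (Fin 3)).sepVec x y⟫_ℝ •
          (hsDiameter σ N)⁻¹ • (Torus.geometry (Fin 3)).sepVec x y,
        w + ⟪v - w, (hsDiameter σ N)⁻¹ • (Torus.geometry (Fin 3)).sepVec x y⟫_ℝ •
          (hsDiameter σ N)⁻¹ • (Torus.geometry (Fin 3)).sepVec x y)) : VelEvent) ∈ splitEvent E)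
    {s t : ℝ} :
    ENNReal.ofReal (∑ᶠ (u : ℝ) (_ : u ∈ collisionTimes (Torus.geometry (Fin 3)) (hsDiameter σ N) (fun t => Φ.flow t z) ∩
        Set.Ioc s t), ∑ i : Fin (N + 1), ∑ j : Fin (N + 1),
          (if i ≠ j ∧ ‖(Torus.geometry (Fin 3)).sepVec (Φ.flow u z i).1 (Φ.flow u z j).1‖ = hsDiameter σ N then
            F u (Φ.flow u z i).1 (Φ.flow u z j).1
              (reflectVel ((Torus.geometry (Fin 3)).sepVec (Φ.flow u z i).1 (Φ.flow u z j).1)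
                ((Φ.flow u z i).2, (Φ.flow u z j).2)).1
              (reflectVel ((Torus.geometry (Fin 3)).sepVec (Φ.flow u z i).1 (Φ.flow u z j).1)
                ((Φ.flow u z i).2, (Φ.flow u z j).2)).2
          else 0)) ≤ 2 * eventSum Φ s t (splitEvent E) z := by
  have htraj := Φ.isTrajectory z hz
  have hfin : (collisionTimes (Torus.geometry (Fin 3)) (hsDiameter σ N) (fun t => Φ.flow t z) ∩ Set.Ioc s t).Finite :=
    htraj.finite_collisionTimes_inter_of_subset_Icc Set.Ioc_subset_Icc_self
  have hnn : ∀ u ∈ hfin.toFinset, 0 ≤ ∑ i : Fin (N + 1), ∑ j : Fin (N + 1),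
      (if i ≠ j ∧ ‖(Torus.geometry (Fin 3)).sepVec (Φ.flow u z i).1 (Φ.flow u z j).1‖ = hsDiameter σ N then
        F u (Φ.flow u z i).1 (Φ.flow u z j).1
          (reflectVel ((Torus.geometry (Fin 3)).sepVec (Φ.flow u z i).1 (Φ.flow u z j).1)
            ((Φ.flow u z i).2, (Φ.flow u z j).2)).1
          (reflectVel ((Torus.geometry (Fin 3)).sepVec (Φ.flow u z i).1 (Φ.flow u z j).1)
            ((Φ.flow u z i).2, (Φ.flow u z j).2)).2
      else 0) := fun u _ =>
    Finset.sum_nonneg fun i _ => Finset.sum_nonneg fun j _ => by split_ifs <;> [exact hF0 _ _ _ _ _; exact le_rfl]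
  rw [finsum_mem_eq_finite_toFinset_sum _ hfin, eventSum, HardSphereFlow.collisionSum_eq,
    Literature.Analysis.FluidPDE.collisionSum_eq_collisionPairSum, collisionPairSum_eq_finset_sum hfin,
    ENNReal.ofReal_sum_of_nonneg hnn, Finset.mul_sum]
  refine Finset.sum_le_sum fun u _ => ?_
  rw [← sum_contactPairs_eq (htraj.mem u) (fun i j => F u (Φ.flow u z i).1 (Φ.flow u z j).1
      (reflectVel ((Torus.geometry (Fin 3)).sepVec (Φ.flow u z i).1 (Φ.flow u z j).1)
        ((Φ.flow u z i).2, (Φ.flow u z j).2)).1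
      (reflectVel ((Torus.geometry (Fin 3)).sepVec (Φ.flow u z i).1 (Φ.flow u z j).1)
        ((Φ.flow u z i).2, (Φ.flow u z j).2)).2)]
  simp only [HardSphereCollisionRecord.ofConfig_fst, HardSphereCollisionRecord.ofConfig_snd]
  exact ofReal_sum_contactPairs_le hσ hσ2 Φ hz hF1 hFs u

/-! ## Pre-emption: a would-be pair that is not realised is pre-empted by ANOTHER would-be pair -/

/-- **The first collision of the system realises a would-be pair.**  On the good set, fix a window
`(s, s + h]` and an ordered would-be pair `p` of `Φ_s z` that is NOT realised (an endpoint is deflected before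
the pair's first free contact time).  Then the FIRST collision of the orbit after `s` happens strictly before
that contact time, between two particles that flew freely from `Φ_s z` — an ordered would-be pair `q` of the
same window with `q ∉ {p, p.swap}` (minimality of the first contact time).  Hence the number of would-be pairs
that are not realised is at most the pair excess `Σ_{p ∈ W} #{q ∈ W : q ∉ {p, p.swap}}`. [folklore] -/
theorem card_sdiff_realisedPairs_le (hσ : 0 < σ) (hσ2 : σ < 1 / 2) (Φ : Flow σ N)
    {z : Config (N + 1) (Fin 3) T3} (hz : z ∈ Φ.good) (s h : ℝ) :
    (wouldBePairs (hsDiameter σ N) h (Φ.flow s z) \ realisedPairs (hsDiameter σ N) h (fun t => Φ.flow t z) s).card ≤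
      ∑ p ∈ wouldBePairs (hsDiameter σ N) h (Φ.flow s z),
        ((wouldBePairs (hsDiameter σ N) h (Φ.flow s z)).filter fun q => q ≠ p ∧ q ≠ p.swap).card := by
  set G := Torus.geometry (Fin 3) with hGdef
  set ε := hsDiameter σ N with hεdef
  have hε : 0 < ε := hsDiameter_pos hσ N
  have hε2 : ε < 2⁻¹ := (hsDiameter_le hσ.le N).trans_lt (by norm_num at hσ2 ⊢; linarith)
  have hG : G.IsHardSphereRegular ε := Torus.isHardSphereRegular_geometry hε2
  set γ : ℝ → Config (N + 1) (Fin 3) T3 := fun t => Φ.flow t z with hγ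
  have htraj : IsHardSphereTrajectory G ε (N + 1) γ := Φ.isTrajectory z hz
  set W := wouldBePairs ε h (γ s) with hW
  set R := realisedPairs ε h γ s with hR
  -- the distance of the free flights of a pair
  set d : Fin (N + 1) × Fin (N + 1) → ℝ → ℝ := fun p u =>
    ‖G.sepVec (freeFlight G u (γ s) p.1).1 (freeFlight G u (γ s) p.2).1‖ with hd
  have hdsymm : ∀ (i j : Fin (N + 1)) (u : ℝ), d (j, i) u = d (i, j) u := fun i j u => by
    simp only [hd, hGdef, Torus.norm_geometry_sepVec, Torus.euclidDist_comm]
  -- every non-realised would-be pair is pre-empted by another would-be pair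
  have hkey : ∀ p ∈ W \ R, ∃ q ∈ W, q ≠ p ∧ q ≠ p.swap := by
    intro p hp
    rw [Finset.mem_sdiff] at hp
    obtain ⟨hpW, hpR⟩ := hp
    obtain ⟨hne, hex⟩ := (mem_wouldBePairs_iff ε h (γ s) p).1 hpW
    -- the first free contact time `t₁ ∈ (0, h]`
    set t₁ := firstContact ε h (γ s) p with ht₁
    obtain ⟨δ, hδ, hsep⟩ := RateFloorWindowPreemption.exists_sep_window htraj hε2 s hne
    have hcont : Continuous (d p) := by
      simpa only [hd, Function.comp_def] using
        (hG.continuous_norm_sepVec_config p.1 p.2).comp (hG.continuous_freeFlight (γ s))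
    have hfc : t₁ ∈ Set.Ioc 0 h ∧ d p t₁ = ε := RateFloorMarkedTransfer.first_contact hcont hδ hsep hex rfl
    -- not realised: an endpoint is deflected at some `u* ∈ (s, s + t₁)`
    have hdefl : ∃ u ∈ Set.Ioo s (s + t₁), Participates G ε (γ u) p.1 ∨ Participates G ε (γ u) p.2 := by
      by_contra hcon
      push Not at hcon
      apply hpR
      simp only [hR, realisedPairs, Finset.mem_filter, Finset.mem_univ, true_and]
      exact ⟨hne, hex, fun u hu => (hcon u hu).1, fun u hu => (hcon u hu).2⟩
    obtain ⟨ustar, hustar, hpart⟩ := hdefl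
    have hustarT : ustar ∈ collisionTimes G ε γ := by
      rcases hpart with h1 | h1 <;> exact mem_collisionTimes_iff_exists_participates.2 ⟨_, h1⟩
    -- the first collision time `u₀ ∈ (s, u*]` of the orbit after `s`
    obtain ⟨⟨hu₀T, hsu₀⟩, hmin⟩ := htraj.isLeast_nthCollisionTime_zero (a := s) ⟨ustar, hustarT, hustar.1⟩
    have hu₀le : nthCollisionTime G ε γ s 0 ≤ ustar := hmin ⟨hustarT, hustar.1⟩
    have hsu₀' : s < nthCollisionTime G ε γ s 0 := hsu₀
    -- the colliding pair at `u₀` flew freely from `γ s`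
    obtain ⟨⟨k, l⟩, hkl⟩ := mem_collisionTimes_iff_contactPairs_nonempty.1 hu₀T
    obtain ⟨hkl', hc⟩ := mem_contactPairs.1 hkl
    have hfree : ∀ m : Fin (N + 1), ∀ u ∈ Set.Ioo s (s + (nthCollisionTime G ε γ s 0 - s)),
        ¬ Participates G ε (γ u) m := by
      intro m u hu hm
      have := hmin ⟨mem_collisionTimes_iff_exists_participates.2 ⟨m, hm⟩, hu.1⟩
      linarith [hu.2]
    have hposk := RateFloorMarkedTransfer.apply_fst_eq_freeFlight_of_not_participates htraj (sub_pos.2 hsu₀') (hfree k)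
    have hposl := RateFloorMarkedTransfer.apply_fst_eq_freeFlight_of_not_participates htraj (sub_pos.2 hsu₀') (hfree l)
    rw [add_sub_cancel] at hposk hposl
    have hdist : d (k, l) (nthCollisionTime G ε γ s 0 - s) = ε := by
      simp only [hd]
      rw [← hposk, ← hposl]
      exact (mem_contactSet.1 hc).2
    have hwin : nthCollisionTime G ε γ s 0 - s ∈ Set.Ioc 0 h := ⟨sub_pos.2 hsu₀', by linarith [hustar.2, hfc.1.2]⟩
    have hqW : ((k, l) : Fin (N + 1) × Fin (N + 1)) ∈ W :=
      (mem_wouldBePairs_iff ε h (γ s) (k, l)).2 ⟨hkl', _, hwin, hdist.le⟩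
    -- minimality of `t₁`: the pair colliding at `u₀` is neither `p` nor `p.swap`
    have hnotp : ∀ q : Fin (N + 1) × Fin (N + 1), d q (nthCollisionTime G ε γ s 0 - s) = ε → d q = d p → False := by
      intro q hq hqp
      rw [hqp] at hq
      have hle : t₁ ≤ nthCollisionTime G ε γ s 0 - s := by
        rw [ht₁, firstContact]
        exact csInf_le ⟨0, fun u hu => hu.1.1.le⟩ ⟨hwin, hq.le⟩
      linarith [hustar.2]
    refine ⟨(k, l), hqW, fun heq => hnotp _ hdist (by rw [heq]), fun heq => hnotp _ hdist ?_⟩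
    funext u
    rw [heq]
    exact hdsymm p.1 p.2 u
  -- counting
  calc (W \ R).card = ∑ _p ∈ W \ R, 1 := by simp
    _ ≤ ∑ p ∈ W \ R, (W.filter fun q => q ≠ p ∧ q ≠ p.swap).card := Finset.sum_le_sum fun p hp => by
        obtain ⟨q, hqW, hq1, hq2⟩ := hkey p hp
        exact Finset.card_pos.2 ⟨q, Finset.mem_filter.2 ⟨hqW, hq1, hq2⟩⟩
    _ ≤ ∑ p ∈ W, (W.filter fun q => q ≠ p ∧ q ≠ p.swap).card :=
        Finset.sum_le_sum_of_subset_of_nonneg Finset.sdiff_subset fun _ _ _ => Nat.zero_le _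

/-- **Would-be sum versus realised sum** for a mark bounded by `1`: the would-be marked sum of a window exceeds the
realised one by at most the number of non-realised would-be pairs (`realisedPairs ⊆ wouldBePairs`). [folklore] -/
theorem wouldBeSum_le_realisedSum_add_card {n : ℕ} (ε Δ : ℝ) (γ : ℝ → Config n (Fin 3) T3) (s : ℝ)
    {F : ℝ → T3 → T3 → V3 → V3 → ℝ} (hF1 : ∀ u x y v w, F u x y v w ≤ 1) :
    wouldBeSum ε Δ (γ s) s F ≤ realisedSum ε Δ γ s F +
      ((wouldBePairs ε Δ (γ s) \ realisedPairs ε Δ γ s).card : ℝ) := by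
  rw [wouldBeSum, realisedSum, ← Finset.sum_sdiff (realisedPairs_subset_wouldBePairs n ε Δ γ s), add_comm]
  refine add_le_add le_rfl ?_
  calc _ ≤ ∑ _p ∈ wouldBePairs ε Δ (γ s) \ realisedPairs ε Δ γ s, (1 : ℝ) :=
        Finset.sum_le_sum fun p _ => hF1 _ _ _ _ _
    _ = _ := by simp

/-! ## The registered helper: the pathwise floor of one window -/

/-- **Registered helper `splitFloorRung0_pathwise`** (stmt-AtomisticToContinuum-9235, line `level-census-comparison`,
input of `stub_splitFloorRung0`).  On the good set, for a window `(s, s + κε]`, a mark `0 ≤ Ξ ≤ 1` with the speed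
cutoffs of the tube functional (`ε(1 + 4κL) < 1/2`) that is nonzero only on the splitting geometry of level `E`:
the static collision-tube double sum of `Φ_s z` is at most TWICE the number of splitting collisions of the orbit
in the window PLUS the pair excess of the would-be pairs of `Φ_s z`
(`tubeSum_trunc_le_wouldBeSum`, the marked realised transfer `stub_markedTransfer stub_realisedDatum` of the line
`Sketch`, `ofReal_collisionFunctional_le_two_mul_eventSum`, `card_sdiff_realisedPairs_le`). [folklore] -/
theorem splitFloorRung0_pathwise : ∀ (σ : ℝ), 0 < σ → σ < 1 / 2 → ∀ (N : ℕ) (Φ : Flow σ N) (z : Config (N + 1) (Fin 3) T3), z ∈ Φ.good → ∀ (s κ L V E : ℝ), 0 < κ → hsDiameter σ N * (1 + 4 * κ * L) < 1 / 2 → ∀ (Ξ : V3 × V3 × V3 → ℝ), (∀ q, 0 ≤ Ξ q) → (∀ q, Ξ q ≤ 1) → (∀ m v v' : V3, 2 * L ≤ ‖v - v'‖ → Ξ (m, v, v') = 0) → (∀ m v v' : V3, 2 * V ≤ ‖v‖ → Ξ (m, v, v') = 0) → (∀ n v w : V3, ‖n‖ = 1 → Ξ (n, v, w) ≠ 0 →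 (((v, w), (v - ⟪v - w, n⟫_ℝ • n, w + ⟪v - w, n⟫_ℝ • n)) : VelEvent) ∈ splitEvent E) → ENNReal.ofReal (∑ i : Fin (N + 1), ∑ j : Fin (N + 1), (if i ≠ j then pairTubeMark (hsDiameter σ N) κ Ξ i j (fun m => (Φ.flow s z m).1) (fun m => (Φ.flow s z m).2) else 0)) ≤ 2 * eventSum Φ s (s + κ * hsDiameter σ N) (splitEvent E) z + ((∑ p ∈ wouldBePairs (hsDiameter σ N) (κ * hsDiameter σ N) (Φ.flow s z), ((wouldBePairs (hsDiameter σ N) (κ * hsDiameter σ N) (Φ.flow s z)).filter fun q => q ≠ p ∧ q ≠ p.swap).card : ℕ) : ℝ≥0∞) := by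
  intro σ hσ hσ2 N Φ z hz s κ L V E hκ hsmall Ξ hΞ0 hΞ1 hΞL hΞV hΞs
  have hε : 0 < hsDiameter σ N := hsDiameter_pos hσ N
  have hε2 : hsDiameter σ N < 2⁻¹ := (hsDiameter_le hσ.le N).trans_lt (by norm_num at hσ2 ⊢; linarith)
  have htraj : IsHardSphereTrajectory (Torus.geometry (Fin 3)) (hsDiameter σ N) (N + 1) (fun t => Φ.flow t z) :=
    Φ.isTrajectory z hz
  have hh : 0 < κ * hsDiameter σ N := mul_pos hκ hε
  -- (1) tube sum ≤ would-be sum (the window floor of the line `Sketch`)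
  have h1 := RateFloorWindowFloor.tubeSum_trunc_le_wouldBeSum (n := N + 1) (L := L) (V := V) hε hκ.le hsmall
    (Φ.flow s z) s (χ := fun _ : ℝ × T3 => (1 : ℝ)) (fun _ => zero_le_one) (Ξ := Ξ) (Ξ' := Ξ) hΞ0
    (fun _ => le_rfl) hΞL hΞV (χt := fun _ => (1 : ℝ)) (fun _ => zero_le_one) (fun _ _ _ _ _ _ => le_rfl)
  have h1' : (∑ i : Fin (N + 1), ∑ j : Fin (N + 1), (if i ≠ j then pairTubeMark (hsDiameter σ N) κ Ξ i j
      (fun m => (Φ.flow s z m).1) (fun m => (Φ.flow s z m).2) else 0)) ≤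
      wouldBeSum (hsDiameter σ N) (κ * hsDiameter σ N) (Φ.flow s z) s
        (fun u x y v w => Ξ ((hsDiameter σ N)⁻¹ • (Torus.geometry (Fin 3)).sepVec x y, v, w)) := by
    simpa only [one_mul] using h1
  -- the mark of the line read through `Ξ`
  have hF0 : ∀ (u : ℝ) (x y : T3) (v w : V3),
      0 ≤ Ξ ((hsDiameter σ N)⁻¹ • (Torus.geometry (Fin 3)).sepVec x y, v, w) := fun u x y v w => hΞ0 _
  have hF1 : ∀ (u : ℝ) (x y : T3) (v w : V3),
      Ξ ((hsDiameter σ N)⁻¹ • (Torus.geometry (Fin 3)).sepVec x y, v, w) ≤ 1 := fun u x y v w => hΞ1 _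
  -- (2) would-be sum ≤ realised sum + #(non-realised would-be pairs)
  have h2 := wouldBeSum_le_realisedSum_add_card (hsDiameter σ N) (κ * hsDiameter σ N) (fun t => Φ.flow t z) s
    (F := fun u x y v w => Ξ ((hsDiameter σ N)⁻¹ • (Torus.geometry (Fin 3)).sepVec x y, v, w)) hF1
  -- (3) realised sum ≤ collision functional (the marked realised transfer of the line `Sketch`)
  have h3 := RateFloorMarkedTransfer.stub_markedTransfer RateFloorRealisedDatum.stub_realisedDatum (N + 1)
    (hsDiameter σ N) (fun t => Φ.flow t z) htraj hε hε2 s (s + κ * hsDiameter σ N) (by linarith)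
    (fun u x y v w => Ξ ((hsDiameter σ N)⁻¹ • (Torus.geometry (Fin 3)).sepVec x y, v, w)) hF0
    (fun p => firstContact (hsDiameter σ N) (κ * hsDiameter σ N) (Φ.flow s z) p)
    (fun p => by simp only [firstContact, add_sub_cancel_left])
    (realisedPairs (hsDiameter σ N) (κ * hsDiameter σ N) (fun t => Φ.flow t z) s)
    (by simp only [realisedPairs, add_sub_cancel_left])
  -- (4) collision functional ≤ 2 · splitting count
  have h4 := ofReal_collisionFunctional_le_two_mul_eventSum hσ hσ2 Φ hz hF0 hF1 (E := E)
    (fun u x y v w hn hne => hΞs _ v w hn hne) (s := s) (t := s + κ * hsDiameter σ N)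
  -- (5) #(non-realised would-be pairs) ≤ pair excess
  have h5 := card_sdiff_realisedPairs_le hσ hσ2 Φ hz s (κ * hsDiameter σ N)
  -- assembly in `ℝ`, then in `ℝ≥0∞`
  have h3' : realisedSum (hsDiameter σ N) (κ * hsDiameter σ N) (fun t => Φ.flow t z) s
      (fun u x y v w => Ξ ((hsDiameter σ N)⁻¹ • (Torus.geometry (Fin 3)).sepVec x y, v, w)) ≤ _ := h3
  have hreal := h1'.trans (h2.trans (add_le_add h3' le_rfl))
  have hCF0 : 0 ≤ realisedSum (hsDiameter σ N) (κ * hsDiameter σ N) (fun t => Φ.flow t z) s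
      (fun u x y v w => Ξ ((hsDiameter σ N)⁻¹ • (Torus.geometry (Fin 3)).sepVec x y, v, w)) :=
    Finset.sum_nonneg fun p _ => hF0 0 _ _ _ _
  refine (ENNReal.ofReal_le_ofReal hreal).trans ?_
  rw [ENNReal.ofReal_add (hCF0.trans h3') (Nat.cast_nonneg _), ENNReal.ofReal_natCast]
  exact add_le_add h4 (by exact_mod_cast h5)

end Flow

end Summit.AtomisticToContinuum.HydrodynamicLimit.Theorems.EnergyCurrentTailsLevelCensus

end
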